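import Summits.MatrixMultiplication.MatrixMultiplication.Theorems.SoloInformedCarrierFamily
import Summits.MatrixMultiplication.MatrixMultiplication.Theorems.SoloInformedWeightedLaser
import Literature.Computability.AlgebraicComplexity.BorderRankSkewCW
import Literature.Computability.AlgebraicComplexity.AsymptoticSpectrum
import Literature.Computability.AlgebraicComplexity.AsymptoticRankBorderRank

/-!
# Block-normal carriers `T_{1,1,M}`: `bR ≥ 5` unless the `c₀`-block is symmetric

Solo deliverable (informed mode), complementing `SoloInformedCarrierFamily` (the family
`cwShapeTensor P Q M` of Coppersmith–Winograd-shaped carriers and its conditional door) and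
`SoloInformedWeightedLaser` / `SoloInformedCarrierRank` (the sub-family `hCarrier μ`).

* `five_le_algBorderRank_cwShape`: for EVERY block-normal carrier `T_{1,1,M}` whose `c₀`-block is
  non-degenerate and NOT symmetric (`M₁₂ ≠ M₂₁`), the `p = 1` Koszul flattening has full rank `9`
  (`rank_koszulBlock₁_cwShape`; the last elimination step is `(M₁₂ − M₂₁)·v₀₀ = 0`), hence
  `bR(T_{1,1,M}) ≥ 5`. Since a symmetric non-degenerate `M` is congruent to `I` over `ℂ`
  (`T_{1,1,M} ≅ T_{cw,2}`, border rank `4`), this says without any classification of blocks: the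
  Coppersmith–Winograd class is the ONLY class of carriers of border rank `4`.
* The Jordan-type class `Γ₂` (`gammaBlock`: `c₀`-block `−a₁b₂ + a₂b₁ + a₂b₂`), the one congruence
  class not covered by the weighted laser engine: an explicit five-term decomposition
  (`cwShapeTensor_gamma_eq_sum_five`), so `bR = R = 5` (`algBorderRank_gammaCarrier`,
  `tensorRank_gammaCarrier`) and `R̃ ∈ [3, 5]`.
* `hCarrier_eq_cwShapeTensor`: the sub-family `hCarrier μ` of `SoloInformedWeightedLaser` is
  `T_{1,1,H(μ)}`, `H(μ)₁₂ = 1`, `H(μ)₂₁ = μ` — so the unconditional doors proved there are doors of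
  members of `cwShapeTensor`.
-/

noncomputable section

namespace Summit.MatrixMultiplication.MatrixMultiplication.Theorems

open Literature.Computability.AlgebraicComplexity

namespace CarrierFamily

/-- `det` of the inner block in coordinates. -/
theorem det_innerBlock (M : Matrix (Fin 3) (Fin 3) ℂ) :
    (innerBlock M).det = M 1 1 * M 2 2 - M 1 2 * M 2 1 := by
  simp [innerBlock, Matrix.det_fin_two]

/-- The `p = 1` Koszul flattening of a block-normal carrier `T_{1,1,M}` with `det M' ≠ 0` and
`M₁₂ ≠ M₂₁` has trivial kernel: six coordinates vanish outright, `(v₀₁, v₀₂)` is killed by the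
transpose of the inner block, and `v₀₀ = v₁₁ = v₂₂` with `(M₁₂ − M₂₁) v₀₀ = 0`.
[cite: ConnerGesmundoLandsbergVentura2022, §4.1] -/
theorem koszulBlock₁_cwShape_mulVec_eq_zero (M : Matrix (Fin 3) (Fin 3) ℂ)
    (hdet : (innerBlock M).det ≠ 0) (hsym : M 1 2 ≠ M 2 1) (u : Fin 3 × Fin 3 → ℂ)
    (hu : (koszulBlock₁ (cwShapeTensor 1 1 M)).mulVec u = 0) : u = 0 := by
  rw [det_innerBlock] at hdet
  have e : ∀ r : Fin 3 × Fin 3,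
      ∑ c : Fin 3 × Fin 3, koszulBlock₁ (cwShapeTensor 1 1 M) r c * u c = 0 := by
    intro r
    have := congrFun hu r
    simpa [Matrix.mulVec, dotProduct] using this
  have e00 := e (0, 0)
  have e01 := e (0, 1)
  have e02 := e (0, 2)
  have e10 := e (1, 0)
  have e11 := e (1, 1)
  have e12 := e (1, 2)
  have e20 := e (2, 0)
  have e21 := e (2, 1)
  have e22 := e (2, 2)
  simp [Fintype.sum_prod_type, Fin.sum_univ_three, koszulBlock₁_apply, cwShapeTensor] at e00
  simp [Fintype.sum_prod_type, Fin.sum_univ_three, koszulBlock₁_apply, cwShapeTensor] at e01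
  simp [Fintype.sum_prod_type, Fin.sum_univ_three, koszulBlock₁_apply, cwShapeTensor] at e02
  simp [Fintype.sum_prod_type, Fin.sum_univ_three, koszulBlock₁_apply, cwShapeTensor] at e10
  simp [Fintype.sum_prod_type, Fin.sum_univ_three, koszulBlock₁_apply, cwShapeTensor] at e11
  simp [Fintype.sum_prod_type, Fin.sum_univ_three, koszulBlock₁_apply, cwShapeTensor] at e12
  simp [Fintype.sum_prod_type, Fin.sum_univ_three, koszulBlock₁_apply, cwShapeTensor] at e20
  simp [Fintype.sum_prod_type, Fin.sum_univ_three, koszulBlock₁_apply, cwShapeTensor] at e21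
  simp [Fintype.sum_prod_type, Fin.sum_univ_three, koszulBlock₁_apply, cwShapeTensor] at e22
  have h01 : u (0, 1) = 0 := by
    have h : (M 1 1 * M 2 2 - M 1 2 * M 2 1) * u (0, 1) = 0 := by
      linear_combination (-(M 2 2)) * e20 + M 1 2 * e10
    exact (mul_eq_zero.1 h).resolve_left hdet
  have h02 : u (0, 2) = 0 := by
    have h : (M 1 1 * M 2 2 - M 1 2 * M 2 1) * u (0, 2) = 0 := by
      linear_combination M 2 1 * e20 - M 1 1 * e10
    exact (mul_eq_zero.1 h).resolve_left hdet
  have h00 : u (0, 0) = 0 := by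
    have h : (M 1 2 - M 2 1) * u (0, 0) = 0 := by
      linear_combination e00 + M 2 1 * e21 + M 2 2 * e22 - M 1 1 * e11 - M 1 2 * e12
    exact (mul_eq_zero.1 h).resolve_left (sub_ne_zero.2 hsym)
  have h11 : u (1, 1) = 0 := by linear_combination e21 + h00
  have h22 : u (2, 2) = 0 := by linear_combination e12 + h00
  funext ⟨a, b⟩
  fin_cases a <;> fin_cases b
  · exact h00
  · exact h01
  · exact h02
  · simpa using e02
  · exact h11
  · simpa using e22
  · simpa using e01
  · simpa using e11
  · exact h22

/-- **Rank `9`** of the `p = 1` Koszul flattening of `T_{1,1,M}` when `det M' ≠ 0`, `M₁₂ ≠ M₂₁`.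
[cite: ConnerGesmundoLandsbergVentura2022, §4.1] -/
theorem rank_koszulBlock₁_cwShape {M : Matrix (Fin 3) (Fin 3) ℂ} (hdet : (innerBlock M).det ≠ 0)
    (hsym : M 1 2 ≠ M 2 1) : (koszulBlock₁ (cwShapeTensor 1 1 M)).rank = 9 := by
  have hinj : Function.Injective (koszulBlock₁ (cwShapeTensor 1 1 M)).mulVecLin := by
    intro v w h
    have h0 : (koszulBlock₁ (cwShapeTensor 1 1 M)).mulVec (v - w) = 0 := by
      rw [Matrix.mulVec_sub]
      exact sub_eq_zero.2 h
    exact sub_eq_zero.1 (koszulBlock₁_cwShape_mulVec_eq_zero M hdet hsym _ h0)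
  rw [Matrix.rank, LinearMap.finrank_range_of_inj hinj]
  simp

/-- **`bR(T_{1,1,M}) ≥ 5` for every non-degenerate, non-symmetric `c₀`-block** (`2·bR ≥ 9`): the
Coppersmith–Winograd class (`M` symmetric, `≅ T_{cw,2}`, `bR = 4`) is the only class of block-normal
carriers of border rank `4` — no classification of blocks needed.
[cite: ConnerGesmundoLandsbergVentura2022, Prop. 3.1, §4.1] -/
theorem five_le_algBorderRank_cwShape {M : Matrix (Fin 3) (Fin 3) ℂ}
    (hdet : (innerBlock M).det ≠ 0) (hsym : M 1 2 ≠ M 2 1) :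
    5 ≤ algBorderRank (cwShapeTensor 1 1 M) := by
  have h :=
    rank_koszulBlock₁_le_two_mul_algBorderRank (TensorRestrictsTo.refl (cwShapeTensor 1 1 M))
  rw [rank_koszulBlock₁_cwShape hdet hsym] at h
  omega

/-! ## The sub-family `hCarrier μ = T_{1,1,H(μ)}` -/

/-- The block `H(μ)`: `H(μ)₁₂ = 1`, `H(μ)₂₁ = μ`. -/
def hBlock (μ : ℂ) : Matrix (Fin 3) (Fin 3) ℂ := fun i j =>
  if i = 1 ∧ j = 2 then 1 else if i = 2 ∧ j = 1 then μ else 0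

/-- `hCarrier μ` (`SoloInformedWeightedLaser`) is the block-normal carrier `T_{1,1,H(μ)}`. -/
theorem hCarrier_eq_cwShapeTensor (μ : ℂ) :
    WeightedLaser.hCarrier μ = cwShapeTensor 1 1 (hBlock μ) := by
  funext i j k
  fin_cases i <;> fin_cases j <;> fin_cases k <;>
    simp [WeightedLaser.hCarrier, cwShapeTensor, hBlock]

/-! ## The Jordan-type class `Γ₂` -/

/-- The block `Γ₂ = [[0,-1],[1,1]]` (Horn–Sergeichuk), as a `3 × 3` array: the one congruence class
of non-degenerate `2 × 2` blocks containing no weighted permutation matrix. -/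
def gammaBlock : Matrix (Fin 3) (Fin 3) ℂ := fun i j =>
  if i = 1 ∧ j = 2 then -1 else if i = 2 ∧ j = 1 then 1 else if i = 2 ∧ j = 2 then 1 else 0

/-- First factors of a five-term decomposition of `T_{1,1,Γ₂}`. [folklore] -/
def gammaFive₁ : Fin 5 → Fin 3 → ℂ :=
  ![![0, 1, 0], ![2⁻¹, 0, 1], ![1, 0, 0], ![0, 1, 1], ![1, 1, 1]]

/-- Second factors of a five-term decomposition of `T_{1,1,Γ₂}`. [folklore] -/
def gammaFive₂ : Fin 5 → Fin 3 → ℂ :=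
  ![![1, 0, 0], ![0, 1, 2], ![0, 1, 0], ![1, 0, -1], ![0, 0, 1]]

/-- Third factors of a five-term decomposition of `T_{1,1,Γ₂}`. [folklore] -/
def gammaFive₃ : Fin 5 → Fin 3 → ℂ :=
  ![![0, 1, -1], ![1, 0, 0], ![-2⁻¹, 1, 0], ![0, 0, 1], ![-1, 0, 1]]

/-- **`T_{1,1,Γ₂}` is a sum of five triads**:
`a₁⊗b₀⊗(c₁−c₂) + (½a₀+a₂)⊗(b₁+2b₂)⊗c₀ + a₀⊗b₁⊗(c₁−½c₀) + (a₁+a₂)⊗(b₀−b₂)⊗c₂ + (a₀+a₁+a₂)⊗b₂⊗(c₂−c₀)`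
(found by the span method on the three `c`-slices; checked entrywise).
[cite: ConnerGesmundoLandsbergVentura2022, §2.2] -/
theorem cwShapeTensor_gamma_eq_sum_five :
    cwShapeTensor 1 1 gammaBlock = ∑ i, triad (gammaFive₁ i) (gammaFive₂ i) (gammaFive₃ i) := by
  funext a b c
  rw [sum_triad_apply, Fin.sum_univ_five]
  fin_cases a <;> fin_cases b <;> fin_cases c <;>
    simp [cwShapeTensor, gammaBlock, gammaFive₁, gammaFive₂, gammaFive₃]
  -- the entry `(a₂, b₂, c₀)`: `Γ₂₂₂ = 1 = 2 - 1`
  norm_num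

/-- `R(T_{1,1,Γ₂}) ≤ 5`. [cite: ConnerGesmundoLandsbergVentura2022, §2.2] -/
theorem tensorRank_gammaCarrier_le_five : tensorRank (cwShapeTensor 1 1 gammaBlock) ≤ 5 :=
  tensorRank_le_of_eq_sum _ _ _ cwShapeTensor_gamma_eq_sum_five

/-- The entries of `Γ₂`. -/
theorem gammaBlock_entries :
    gammaBlock 1 1 = 0 ∧ gammaBlock 1 2 = -1 ∧ gammaBlock 2 1 = 1 ∧ gammaBlock 2 2 = 1 := by
  simp [gammaBlock]

/-- `Γ₂` is not symmetric. -/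
theorem gammaBlock_not_symm : gammaBlock 1 2 ≠ gammaBlock 2 1 := by
  rw [gammaBlock_entries.2.1, gammaBlock_entries.2.2.1]
  norm_num

/-- `det Γ₂ = 1 ≠ 0`. -/
theorem det_innerBlock_gammaBlock_ne_zero : (innerBlock gammaBlock).det ≠ 0 := by
  rw [det_innerBlock, gammaBlock_entries.1, gammaBlock_entries.2.1, gammaBlock_entries.2.2.1,
    gammaBlock_entries.2.2.2]
  norm_num

/-- **`bR(T_{1,1,Γ₂}) = 5`**. [cite: ConnerGesmundoLandsbergVentura2022, Prop. 3.1] -/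
theorem algBorderRank_gammaCarrier : algBorderRank (cwShapeTensor 1 1 gammaBlock) = 5 := by
  refine le_antisymm ((algBorderRank_le_tensorRank _).trans tensorRank_gammaCarrier_le_five) ?_
  exact five_le_algBorderRank_cwShape det_innerBlock_gammaBlock_ne_zero gammaBlock_not_symm

/-- `R(T_{1,1,Γ₂}) = 5`. [cite: ConnerGesmundoLandsbergVentura2022, Prop. 3.1] -/
theorem tensorRank_gammaCarrier : tensorRank (cwShapeTensor 1 1 gammaBlock) = 5 :=
  le_antisymm tensorRank_gammaCarrier_le_five
    ((five_le_algBorderRank_cwShape det_innerBlock_gammaBlock_ne_zero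
      gammaBlock_not_symm).trans (algBorderRank_le_tensorRank _))

/-- `innerBlock 1 = 1`. -/
theorem innerBlock_one : innerBlock (1 : Matrix (Fin 3) (Fin 3) ℂ) = 1 := by
  ext i j
  fin_cases i <;> fin_cases j <;> simp [innerBlock]

/-- The kernel interval `3 ≤ R̃(T_{1,1,Γ₂}) ≤ 5` for the Jordan-type carrier (whose door
`R̃ = 3 ⇒ ω = 2` is the conditional `matrixMultiplication_of_cwShape_door`).
[cite: BurgisserClausenShokrollahi1997, Lemma (15.27)] -/
theorem asymptoticRank_gammaCarrier_mem :
    (3 : ℝ) ≤ asymptoticRank (cwShapeTensor 1 1 gammaBlock) ∧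
      asymptoticRank (cwShapeTensor 1 1 gammaBlock) ≤ 5 := by
  refine ⟨three_le_asymptoticRank_cwShapeTensor (by rw [innerBlock_one]; simp)
    (by rw [innerBlock_one]; simp), ?_⟩
  have h := asymptoticRank_le_algBorderRank (cwShapeTensor 1 1 gammaBlock)
  rw [algBorderRank_gammaCarrier] at h
  exact_mod_cast h

end CarrierFamily

end Summit.MatrixMultiplication.MatrixMultiplication.Theorems

end
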